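import Summits.CriticalPhenomena.CardyFormulaZ2.Theorems.CardyBoundaryCoulombGasHalfPlaneMarkDensityLawWiredCardy
import Summits.CriticalPhenomena.CardyFormulaZ2.Theorems.CardyBoundaryCoulombGasHalfPlaneMarkDensityLawNoFreeConstant

/-!
# `HalfPlaneMarkDensityLaw` (crux stmt-CriticalPhenomena-5661), line `Sketch`, wired duality:
# stub `halfPlaneWiredCardy_iff_threeArc_of` (C10') — the target of route CardyTotalPositivity
# (`HalfPlaneWiredCardy`, stmt-CriticalPhenomena-9321) is the identification of the THREE-ARC limits

Glue.  `P_n(a,b,c,y) := P_{1/2}[[⌊an⌋,⌊bn⌋]×{0} ↔ [⌊cn⌋,⌊yn⌋]×{0} in ℤ×ℕ]` on the chamber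
`a < b < c < y`; a joint subsequential limit `G` of `P_{θ n}` along a strictly increasing `θ`.

* (W1) for `σ, x > 0` the wired values `M ↦ G(−M, −σ, 1/M, x)` converge to some `W = W_G(σ,x)`, and
  the wired kernel `P_{θ n}(σ,x) = P_{1/2}[(−∞,−⌊σ θn⌋]×{0} ↔ [1,⌊x θn⌋]×{0} in ℤ×ℕ]` tends to `W`;
* (T1) for `a < b < c` the three-arc limit `lim_{y→∞} G(a,b,c,y)` exists and equals `W_G(c−b, b−a)`.

**Claim (C10).** `HalfPlaneWiredCardy ⟺` for every joint subsequential limit `G` and `a < b < c`,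
`lim_{y→∞} G(a,b,c,y) = F((b−a)/(c−a))`.

**Proof.** `⟹`: with `σ = c − b`, `x = b − a`, the wired kernel along `θ` tends both to `W` (W1) and to
`F(x/(x+σ))` (the hypothesis, along the subsequence `θ`), so `W = F(x/(x+σ)) = F((b−a)/(c−a))`, and by
(T1) the three-arc limit is `W`.  `⟸`: by the subsequence principle it suffices to find, inside every
sequence `ns → ∞`, a subsequence along which the wired kernel tends to `F(x/(x+σ))`; extract a strictly
increasing subsequence, then a joint subsequential limit `G` (precompactness,
`Subseq.exists_jointSubseqLimit`); along it the wired kernel tends to `W` (W1), and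
`W = lim_M G(−M,−σ,1/M,x) = lim_y G(0,x,x+σ,y)` (T1 at `(0, x, x+σ)`) `= F(x/(x+σ))` (the hypothesis).
-/

noncomputable section

namespace Summit.CriticalPhenomena.CardyFormulaZ2.Cruxes.HalfPlaneMarkDensityLaw.SketchLine

open Literature.Probability.Percolation Literature.Probability.LatticeModels
open MeasureTheory Filter Set
open scoped Topology
open Summit.CriticalPhenomena.CardyFormulaZ2.Theorems.HalfPlaneMarkDensityLaw.Negative

namespace WiredDual

/-- **C10 from W1 and T1** (glue): given (W1) the convergence of the wired values of every joint
subsequential limit together with the wired kernel along the subsequence, and (T1) the existence of the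
three-arc limits and their equality with the wired limits, the wired three-mark half-plane Cardy law
`HalfPlaneWiredCardy` (stmt-CriticalPhenomena-9321) holds if and only if the three-arc limits of every
joint subsequential limit are `F((b−a)/(c−a))` (precompactness `Subseq.exists_jointSubseqLimit` + the
subsequence principle). [folklore] -/
theorem halfPlaneWiredCardy_iff_threeArc_of :
    (∀ {θ : ℕ → ℕ} {G : ℝ → ℝ → ℝ → ℝ → ℝ}, (∀ a b c y : ℝ, a < b → b < c → c < y → Tendsto (fun n ↦ μ.real (openCrossing halfPlane (arcA a b (θ n)) (rowIcc ⌊c * (θ n : ℕ)⌋ ⌊y * (θ n : ℕ)⌋))) atTop (𝓝 (G a b c y))) → StrictMono θ → ∀ σ x : ℝ, 0 < σ → 0 < x → ∃ W : ℝ, Tendsto (fun M : ℕ ↦ G (-(M : ℝ)) (-σ) ((M : ℝ)⁻¹) x) atTop (𝓝 W) ∧ Tendsto (fun n ↦ μ.real (openCrossing halfPlane {v : Site 2 | v 1 = 0 ∧ v 0 ≤ -⌊σ * (θ n : ℕ)⌋} {v : Site 2 | v 1 = 0 ∧ 1 ≤ v 0 ∧ v 0 ≤ ⌊x * (θ n :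 ℕ)⌋})) atTop (𝓝 W)) →
    (∀ {θ : ℕ → ℕ} {G : ℝ → ℝ → ℝ → ℝ → ℝ}, (∀ a b c y : ℝ, a < b → b < c → c < y → Tendsto (fun n ↦ μ.real (openCrossing halfPlane (arcA a b (θ n)) (rowIcc ⌊c * (θ n : ℕ)⌋ ⌊y * (θ n : ℕ)⌋))) atTop (𝓝 (G a b c y))) → StrictMono θ → ∀ a b c : ℝ, a < b → b < c → ∃ L : ℝ, Tendsto (fun y : ℝ ↦ G a b c y) atTop (𝓝 L) ∧ Tendsto (fun M : ℕ ↦ G (-(M : ℝ)) (-(c - b)) ((M : ℝ)⁻¹) (b - a)) atTop (𝓝 L)) →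
    (Summit.CriticalPhenomena.CardyFormulaZ2.Theses.CardyTotalPositivity.HalfPlaneWiredCardy ↔
      ∀ θ : ℕ → ℕ, StrictMono θ → ∀ G : ℝ → ℝ → ℝ → ℝ → ℝ,
        (∀ a b c y : ℝ, a < b → b < c → c < y →
        Tendsto (fun n ↦ μ.real (openCrossing halfPlane (arcA a b (θ n))
          (rowIcc ⌊c * (θ n : ℕ)⌋ ⌊y * (θ n : ℕ)⌋))) atTop (𝓝 (G a b c y))) →
        ∀ a b c : ℝ, a < b → b < c →
          Tendsto (fun y : ℝ ↦ G a b c y) atTop (𝓝 (Literature.Probability.RandomPlanarGeometry.cardyFunction ((b - a) / (c - a))))) := by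
  intro hW1 hT1
  constructor
  · -- `⟹`: the wired kernel along `θ` identifies `W`, and (T1) identifies the three-arc limit with `W`.
    intro hWC θ hθ G hG a b c hab hbc
    have hσ : 0 < c - b := sub_pos.2 hbc
    have hx : 0 < b - a := sub_pos.2 hab
    obtain ⟨W, hW₁, hW₂⟩ := hW1 hG hθ (c - b) (b - a) hσ hx
    have hWC' : ∀ σ x : ℝ, 0 < σ → 0 < x →
        Tendsto (fun n : ℕ ↦ μ.real (openCrossing halfPlane {v : Site 2 | v 1 = 0 ∧ v 0 ≤ -⌊σ * n⌋}
          {v : Site 2 | v 1 = 0 ∧ 1 ≤ v 0 ∧ v 0 ≤ ⌊x * n⌋})) atTop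
          (𝓝 (Literature.Probability.RandomPlanarGeometry.cardyFunction (x / (x + σ)))) := hWC
    have hfull := (hWC' (c - b) (b - a) hσ hx).comp hθ.tendsto_atTop
    have hWF : W = Literature.Probability.RandomPlanarGeometry.cardyFunction ((b - a) / ((b - a) + (c - b))) :=
      tendsto_nhds_unique hW₂ hfull
    obtain ⟨L, hL₁, hL₂⟩ := hT1 hG hθ a b c hab hbc
    have hLW : L = W := tendsto_nhds_unique hL₂ hW₁
    have hca : (b - a) + (c - b) = c - a := by ring
    rw [hLW, hWF, hca] at hL₁
    exact hL₁
  · -- `⟸`: the subsequence principle, precompactness, (W1), (T1) at `(0, x, x + σ)` and the hypothesis.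
    intro h3 σ x hσ hx
    refine tendsto_of_subseq_tendsto fun ns hns ↦ ?_
    obtain ⟨φ₁, _, hmono⟩ := strictMono_subseq_of_tendsto_atTop hns
    obtain ⟨ψ, hψ, G, hG⟩ := Subseq.exists_jointSubseqLimit (ns ∘ φ₁) hmono
    refine ⟨φ₁ ∘ ψ, ?_⟩
    have hθ : StrictMono ((ns ∘ φ₁) ∘ ψ) := hmono.comp hψ
    obtain ⟨W, hW₁, hW₂⟩ := hW1 (θ := (ns ∘ φ₁) ∘ ψ) (G := G) hG hθ σ x hσ hx
    obtain ⟨L, hL₁, hL₂⟩ := hT1 (θ := (ns ∘ φ₁) ∘ ψ) (G := G) hG hθ 0 x (x + σ) hx (by linarith)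
    have h3' := h3 ((ns ∘ φ₁) ∘ ψ) hθ G hG 0 x (x + σ) hx (by linarith)
    have hLF : L = Literature.Probability.RandomPlanarGeometry.cardyFunction ((x - 0) / (x + σ - 0)) :=
      tendsto_nhds_unique hL₁ h3'
    have e1 : x + σ - x = σ := by ring
    have e2 : x - 0 = x := sub_zero x
    have e3 : x + σ - 0 = x + σ := sub_zero (x + σ)
    rw [e2, e3] at hLF
    simp only [e1, e2] at hL₂
    have hLW : L = W := tendsto_nhds_unique hL₂ hW₁
    rw [← hLF, hLW]
    exact hW₂

end WiredDual

end Summit.CriticalPhenomena.CardyFormulaZ2.Cruxes.HalfPlaneMarkDensityLaw.SketchLine
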